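import Summits.QuantumFields.YangMills.Theorems.BalabanUVNodesN12MinimiserFamilyOfClassDatumLettersOnZUniform
import Literature.MathematicalPhysics.QuantumFieldTheory.Balaban1983to89.Node00.MultiScaleFibreChartB
import Literature.MathematicalPhysics.QuantumFieldTheory.Balaban1983to89.B15Prop1GradientFromNearValueB
import Literature.MathematicalPhysics.QuantumFieldTheory.Balaban1983to89.B15Prop1MinimiserTowerAxialGaugeB
import Summits.QuantumFields.YangMills.Theorems.BalabanUVNodesN12GaugeLetterLocExplicitOnZLam
import Summits.QuantumFields.YangMills.Theorems.BalabanUVNodesN12HVelocityOfClassB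
import Summits.QuantumFields.YangMills.Theorems.BalabanUVNodesN12MinimiserFamilyOfClassThresholdUniformB
import Summits.QuantumFields.YangMills.Theorems.BalabanUVNodesN12MultiplierLetterOfClassB
import Summits.QuantumFields.YangMills.Theorems.BalabanUVNodesN12SliceDatumCurvatureOfClassB
import HarnessLib

/-!
# DAG node N12 [B15] — THE onZ EDITION «U3-onZ» OF THE εreg-UNIFORM (J0′) PRODUCER WITH DATUM LETTERS (`…N12MinimiserFamilyOfClassDatumLettersUniform` = «U3», p725063): the (σ)_N letter of — **BOND-DATUM EDITION** (`…N12MinimiserFamilyOfClassDatumLettersOnZUniformB`, USED DECLARATIONS ONLY)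

The print-datum ([Balaban1984PropagatorsII] (2.3)) (γ) twin of `Summits/…/Theorems/BalabanUVNodesN12MinimiserFamilyOfClassDatumLettersOnZUniform.lean`: the declarations of the parent whose STATEMENT reads the determining datum
(`hMin_atRecord_of_node00Letters_thm1AtBase_central_ofClass_datumLettersOnZ_uniform`) and which N12's junction of record v14ᴸ uses (dag-n12-c g35 probe-2 census `UsedConstsN12RoadTyped2`, THEOREMS block), re-typed over a
BOND-LEVEL datum `𝔅 : BDetSet` (F0a `B15DeterminingSetsB`) and dag-n12-c's bond-datum chart `Node00.msChartB` (✓p774329; `msChart 𝐁 = msChartB (bondsDet 𝐁)` by `rfl`).  GENERATOR twin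
(this seat's `work/g32/gen_thm.py`, block-extracted from the parent's tree bytes): namespace `…N12MinimiserFamilyOfClassDatumLettersOnZUniformB`, SAME short names, `DetSet ↦ BDetSet`, `AgreeOn 𝐁 ↦ AgreeOnB 𝔅`,
`IsMinimizer ↦ IsMinimizerB`, `bondsOf (𝐁 j) ↦ 𝔅 j`, `msChart ∕ constrCard ∕ constrEnum ∕ ConstrSet ↦ …B`, NODE 00 chart lemmas `…msChart… ↦ …msChartB…`; proofs VERBATIM; the parent's
datum-free declarations REUSED BY NAME (`open`), never copied (private plumbing excepted, №366 R2).  The parent's (b) statements are the instances `𝔅 := bondsDet 𝐁`.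
V5u-onZ AT PRINT`s DATUM: the (δ) row of 161`s residual form is DISCHARGED on the plaquettes meeting the TOUCHING set `{b | b.src ∈ Ω₁(Z) ∨ b.tgt ∈ Ω₁(Z)}` (161`s `S₀`, with `hS₀` = n12-c`s `mem_lamDatumP_maxDomT_zero_of_not_mem₂` and `hS₀1` trivial) from dag-n12-c`s ✓p781991 `…GaugeLetterLocExplicitOnZLam.exists_gaugeLetterLoc_atRecord_lamBondsSeq_explicit_onZ` — its THIRD conjunct (the residual gauge is `T(ρn, εr)`-flat on EVERY bond inside `Z`) + the NEW geometric lemma `corners_mem_of_touching` (the touching-set edition of `N12GaugeLetterLocExplicitOnZ.corners_mem_of_sourced`: a plaquette meeting a bond that touches `Ω₁(Z)` has all its corners in `Z`, by dag-n12-w6`s `…FarDatumSurgeryPrelim` near-lemmas at radius `4 ≤ side − 1`); everything else VERBATIM over 161; `hHB` in (b)-currency.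
Cell `pub-ymgap` (HUMAN RULINGS D-0062 ∕ D-0149), seat `pub-ymgap-dag-n12-d` g32 (R134 N12 [B15] s2; the (ii) Theorems-side re-key of N12's road at print's [II] (2.3) datum — director-ym №338 ∕
№343 (E1)(iii-b), FLAG №16 ∕ ruling (α); dag-n12-c DESIGN memo a793b2ebc0b803bf (ii); `N12-ROAD-TWIN-ORDER-2026-08-30.md`).  Count-neutral helper of K1⁹ `stmt-QuantumFields-27364`,
`--kind proof --supports … --as helper`.  THEOREMS ONLY (0 `def`, 0 `instance`, 0 `sorry`).

HONEST FRAMING (director-ym №338 (5)).  PURELY ADDITIVE: the parent stays landed and true on its own text; nothing in it is edited; no displayed premise of any consumer is deleted or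
weakened; every hypothesis of the parent stays a hypothesis.  Nothing of Bałaban's analysis asserted; N12 NOT discharged; K0⁷ ∕ K1⁹ NOT closed; counts unmoved (typed 28∕28 · discharged
8∕27, A 8∕28; K 1∕4); one finite 𝕋⁴ programme at fixed ε — R4 closes the conditional rung `BalabanLadder.UV` only; NOT the Yang–Mills mass gap (Clay); nothing continuum ∕ ℝ⁴ ∕ OS.

PARENT's DOCSTRING (the mathematics and the citations; read the site-level `𝐁` as the bond datum `𝔅`):
# DAG node N12 [B15] — THE onZ EDITION «U3-onZ» OF THE εreg-UNIFORM (J0′) PRODUCER WITH DATUM LETTERS (`…N12MinimiserFamilyOfClassDatumLettersUniform` = «U3», p725063): the (σ)_N letter of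
# record is taken in dag-n12-w6 g18's onZ form `N12GaugeLetterLocExplicitOnZ.exists_gaugeLetterLoc_atRecord_explicit_onZ` — per base field the datum letter reads the `k`-bonds INSIDE
# `Z^{(k)}` only; the instance-level region rows `𝒞 N hGN hN1 hGmem` are GONE

[Balaban1989LargeFieldII] = «[LF-II]», p. 357, (1.12)–(1.13) p. 359; [Balaban1989LargeFieldI] = «[IV]», (1.74) p. 192, p. 193 (the extension), p. 194 (the sentence after (1.77): the datum is
read on its gauge orbit), Prop. 1 p. 194; [Balaban1985Variational] = «[15]», (2)–(4) p. 278, Thm 1 p. 279, (16)–(18) p. 280, Sect. C (44)–(48) p. 285, (181) p. 307; [Balaban1985RegularSpaces]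
(1.7) p. 77, (1.19) p. 79; [Balaban1985Averaging] = «[4]», Prop. 2 (52)–(53) p. 26, (122)–(126) p. 36; [Balaban1988Convergent] = «[III]», (1.3) p. 246, (2.2) p. 255, (2.10)–(2.13) pp. 256–257,
(2.16) p. 257.

Cell `pub-ymgap`, HUMAN RULINGS D-0062 ∕ D-0149, lane owner `pub-ymgap-dag-n12-c` (g27, strategy s1).  Key K1⁹ `stmt-QuantumFields-27364`, `--kind proof --supports … --as helper`; count-neutral.
NEW leaf; CONSUMED BY NAME, nothing modified: `…N12MinimiserFamilyOfClassThresholdUniform` §3 (the residual-gauge form with `δ₀` first) and dag-n12-w6 g18's onZ (σ)_N letter of record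
`N12GaugeLetterLocExplicitOnZ.exists_gaugeLetterLoc_atRecord_explicit_onZ` (p732020; stated for EVERY `ν`, here at `ν⟨εreg := εr⟩`).

WHY — LOCATED-U3-GLOBAL (the lane, g27) = ⚑ LOCATED-DATUM-FAR (dag-n12-w6 g18), pub-ymgap INBOX 2026-08-29.  U3 keys on w3's GLOBAL explicit corner, whose shadow geometry letter `hGmem`
ranges at level `0` over EVERY bond touching `Ω₁(Z)ᶜ`; any admissible `𝒞` then contains the `k`-shadows of all exterior face-crossing bonds and the datum letter `∀ c ∈ 𝒞, dist1 ((ext V_k) c)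
≤ ρn` asks the rough exterior datum to be flat — uninhabitable far from `Z` in ANY gauge (w6's holonomy witness: `V_k″ := 1` except `−1` on one `k`-bond off `Z`).  w6's cure (p731874
`N12FarDatumSurgery`: (2.12) minimisers do not read the datum off `Z^{(k)}`; p732020: the (σ)_N letter with ONE datum hypothesis on the `k`-bonds inside `Z^{(k)}`) makes the letter live where
the guard lives.  THIS FILE is U3 re-keyed on it: `δ₀` first, the `εr` rows, the class facts, `ρn`, «`T(ρn, εr) ≤ δ₀`», then per base field (E) · datum plaquette regularity · the DATUM
LETTER ON `Z^{(k)}` · (T1@q₀) — U3 VERBATIM otherwise.  On the lane's orbit road (`B15Prop1MinimiserFamilyGaugeCovariance`, `B15Prop1MinimiserFamilyOfNormalisedSlice`) the onZ letter is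
inhabited from the knit's guard by dag-n12-w6's normalising gauge whenever the `k`-bonds inside `Z^{(k)}` lie in the region box — the direct road's BOX SCOPE, displayed there.

CONTENTS (namespace `Summit.QuantumFields.YangMills.BalabanUVNodes.N12MinimiserFamilyOfClassDatumLettersOnZUniform`; one theorem, no `def`, no `instance`, no `sorry`).
★★★ `hMin_atRecord_of_node00Letters_thm1AtBase_central_ofClass_datumLettersOnZ_uniform`.

HONEST FRAMING ∕ LOCATED.  Composition by name + binder order; (E) and (T1@q₀) remain [15] Thm 1's rows (fed from the lane's `B15Prop1Thm1RowsOfExistsUnique` by consumers); the datum letter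
is a gauge condition on `Z^{(k)}` (LOCATED-GEOM v3 scope for ring-like `Z`: no gauge flattens a datum with large holonomy — displayed); `δ₀` EXISTENTIAL per (instance, height); nothing of
Bałaban's estimates asserted; count-neutral helper; N12 NOT discharged; K1⁹ NOT closed; counts unmoved; one finite 𝕋⁴ programme at fixed ε — R4 closes the conditional finite-𝕋⁴ rung
`BalabanLadder.UV` only; NOT continuum ∕ OS ∕ mass gap ∕ Clay.
-/

noncomputable section

open scoped BigOperators Matrix.Norms.L2Operator Topology

namespace Summit.QuantumFields.YangMills.BalabanUVNodes.N12MinimiserFamilyOfClassDatumLettersOnZUniformB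

open Literature.MathematicalPhysics.QuantumFieldTheory.Balaban1983to89.B15DeterminingSetsB

open Set Metric Filter
open Literature.MathematicalPhysics.QuantumFieldTheory.Balaban1983to89
open Literature.MathematicalPhysics.QuantumFieldTheory.Balaban1983to89.Node00 (SU coeField coeField_apply SmallBelow ConstrSetB constrCardB constrEnumB dIterL)
open T4Continuum B15DeterminingSets GaugeField
open B14.Eq213MaximalDomains (side)
open B14.Eq213DetSet (Bj Bj_of_gt Bj_zero maxDomT)
open B15Prop1Carrier (plaqsInside)
open B15AveragingHolomorphic (iterMh)
open B15ComplexifiedDatumFamily (conjVec)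
open B15SU2ChartHolomorphic (genE expMulC logCoordC)
open B15Prop1AnalyticExtClause (cplxVec norm_cplxVec_apply)
open B15Prop1ChartCalculusSU2 (E3)
open B15Prop1ChartSU2 (su2Chart)
open B15ShellGauge193 (shellGauge)
open B15Extension193 (extend)
open B16Sect1Backgrounds (toMS expMul)
open ExpMeanLog (expMeanLogSU)
open BlockAveraging (blockAvg)
open T4CubeChartGnomonic (SU2)
open Literature.MathematicalPhysics.QuantumFieldTheory.BalabanImbrieJaffe1984to88.BIJ85Eq453GaugeField (qsstarGIter0)
open Summit.QuantumFields.YangMills.BalabanUVNodes.N12MinimiserFamilyOfClassGaugeRow (hMin_atRecord_of_node00Letters_thm1AtBase_central_ofClass_gaugeRow)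
open Summit.QuantumFields.YangMills.BalabanUVNodes.N12MultiplierLetterOfClassB (multiplierLetter_lamBondsSeq_of_isMinimizer_class_of_curvatureLetter)
open Summit.QuantumFields.YangMills.BalabanUVNodes.N12HVelocityOfClassB (hH_velocity_lamBondsSeq_of_isMinimizer_class)
open B15Prop1MinimiserTowerAxialGaugeB (isMinimizer_gaugeAct_of_residual)
open B15Eq177ValueInvarianceCoDiv (gaugeAct_mem_regMSCoPOfRecord)
open B16Sect1Backgrounds (mulG gaugeAct_gaugeAct)
open B14Eq16FaddeevPopov (wilsonAction4_gaugeAct')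
open Summit.QuantumFields.YangMills.BalabanUVNodes.N12SliceDatumCurvatureOfClassB (exists_uniform_sliceDatum_curvatureLetter_of_class)
open B5Eq118OneStroke (iterBlockOf)
open B14.Eq216Concrete (feeds)
open B15Eq112TorusCover (lift)
open T4AxialGaugeSmallField (boxPlaqs)
open T4AdjointCovarianceUnitary (lieSU)
open Node00 (msChartB avOfRecord regMSCoPOfRecord)
open scoped Matrix.Norms.L2Operator

open Summit.QuantumFields.YangMills.BalabanUVNodes.N12MinimiserFamilyOfClassThresholdUniformB (hMin_atRecord_of_node00Letters_thm1AtBase_central_ofClass_threshold_residual_uniform)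
open Summit.QuantumFields.YangMills.BalabanUVNodes.N12GaugeLetterLocExplicitOnZLam (exists_gaugeLetterLoc_atRecord_lamBondsSeq_explicit_onZ)
open ExpMeanLog (deltaSU)
open B14.Eq22Determines (blockIter)
open Node00 (msChart constrCard constrEnum)
open B15Prop1GradientFromNearValue (mem_lamDatumP_maxDomT_zero_of_not_mem₂)

section TouchingCorners

open B14DomainGeom (Pt Within)
open B15Eq112TorusCover (cover)
open B10StarCount (unshift_shift)
open Summit.QuantumFields.YangMills.BalabanUVNodes.N12FarDatumSurgeryPrelim (near_of_mem_maxDomT near_shift near_unshift near_mono mem_of_near margin_le)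

variable {F : T4Family} {Kt k : ℕ} {ν : Node00.Stage7Numerics} {Z : Set (Site (F.P Kt) 0)}

/-- **THE CORNERS OF A PLAQUETTE MEETING A BOND THAT TOUCHES `Ω₁(Z)` LIE IN `Z`** — the TOUCHING-set edition of `N12GaugeLetterLocExplicitOnZ.corners_mem_of_sourced` (there: a bond
SOURCED in `Ω₁(Z)`; at print's [II] (2.3) datum the level-0 support set is the set of bonds with EITHER end-point in `Ω₁(Z)`): the source of such a plaquette is within two lattice steps
of `Ω₁(Z)`, its corners within four, and `Ω₁(Z)` keeps the distance `side(L, M₁, 1) − 1 ≥ 2M₁ + 3` from the complement of `Z` (`margin_le`, `M₁ ≥ 4`).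
[cite: Balaban1985RegularSpaces, p.77 (convention before (1.5)); Balaban1984PropagatorsII, (2.3) p.224] -/
theorem corners_mem_of_touching (hM4 : 4 ≤ ν.M₁) (hk1 : 1 ≤ k) (hdiv : side (F.P Kt).L ν.M₁ k ∣ (F.P Kt).sitesPerDir 0) (p : Plaq (F.P Kt) 0)
    (hp : ((⟨p.src, p.μ⟩ : PBond (F.P Kt) 0) ∈ {b : PBond (F.P Kt) 0 | b.src ∈ maxDomT ν.M₁ Z 1 ∨ b.tgt ∈ maxDomT ν.M₁ Z 1} ∨
            (⟨p.src.shift p.μ, p.ν⟩ : PBond (F.P Kt) 0) ∈ {b : PBond (F.P Kt) 0 | b.src ∈ maxDomT ν.M₁ Z 1 ∨ b.tgt ∈ maxDomT ν.M₁ Z 1} ∨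
            (⟨p.src.shift p.ν, p.μ⟩ : PBond (F.P Kt) 0) ∈ {b : PBond (F.P Kt) 0 | b.src ∈ maxDomT ν.M₁ Z 1 ∨ b.tgt ∈ maxDomT ν.M₁ Z 1} ∨
            (⟨p.src, p.ν⟩ : PBond (F.P Kt) 0) ∈ {b : PBond (F.P Kt) 0 | b.src ∈ maxDomT ν.M₁ Z 1 ∨ b.tgt ∈ maxDomT ν.M₁ Z 1})) :
    p.src ∈ Z ∧ p.src.shift p.μ ∈ Z ∧ p.src.shift p.ν ∈ Z ∧ (p.src.shift p.μ).shift p.ν ∈ Z ∧ (p.src.shift p.ν).shift p.μ ∈ Z := by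
  have hM : 1 ≤ ν.M₁ := le_trans (by norm_num) hM4
  have hm := margin_le (F := F) (Kt := Kt) hM4
  have hM4' : (4 : ℤ) ≤ (ν.M₁ : ℤ) := by exact_mod_cast hM4
  -- `p.src` is within two backward steps of a point of `Ω₁(Z)`
  have hsrc : ∃ z₁ z : Pt (F.P Kt).d, cover (F.P Kt) z₁ ∈ maxDomT ν.M₁ Z 1 ∧ cover (F.P Kt) z = p.src ∧ Within (0 + 1 + 1) z₁ z := by
    rcases hp with (h | h) | (h | h) | (h | h) | (h | h)
    · exact near_mono (by norm_num) (near_of_mem_maxDomT (Z := Z) hM le_rfl h)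
    · have := near_unshift (near_of_mem_maxDomT (Z := Z) hM le_rfl h) p.μ
      simp only [PBond.tgt, unshift_shift] at this
      exact near_mono (by norm_num) this
    · have := near_unshift (near_of_mem_maxDomT (Z := Z) hM le_rfl h) p.μ
      simp only [unshift_shift] at this
      exact near_mono (by norm_num) this
    · have := near_unshift (near_unshift (near_of_mem_maxDomT (Z := Z) hM le_rfl h) p.ν) p.μ
      simp only [PBond.tgt, unshift_shift] at this
      exact this
    · have := near_unshift (near_of_mem_maxDomT (Z := Z) hM le_rfl h) p.ν
      simp only [unshift_shift] at this
      exact near_mono (by norm_num) this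
    · have := near_unshift (near_unshift (near_of_mem_maxDomT (Z := Z) hM le_rfl h) p.μ) p.ν
      simp only [PBond.tgt, unshift_shift] at this
      exact this
    · exact near_mono (by norm_num) (near_of_mem_maxDomT (Z := Z) hM le_rfl h)
    · have := near_unshift (near_of_mem_maxDomT (Z := Z) hM le_rfl h) p.ν
      simp only [PBond.tgt, unshift_shift] at this
      exact near_mono (by norm_num) this
  exact ⟨mem_of_near hM hk1 hdiv (by linarith) hsrc, mem_of_near hM hk1 hdiv (by linarith) (near_shift hsrc p.μ),
    mem_of_near hM hk1 hdiv (by linarith) (near_shift hsrc p.ν), mem_of_near hM hk1 hdiv (by linarith) (near_shift (near_shift hsrc p.μ) p.ν),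
    mem_of_near hM hk1 hdiv (by linarith) (near_shift (near_shift hsrc p.ν) p.μ)⟩

end TouchingCorners

section
variable {F : T4Family} {k : ℕ}

/-- ★★★ **V5u-onZ — THE (J0′) PRODUCER WITH THE DATUM LETTER ON `Z^{(k)}`, THRESHOLD FIRST.**  Instance-level: the capstone's record data + one forest + the (σ)_N level guard, radii ∕
support lower bounds on `M₁` (NO region rows); per height the radius letter at `ρ″ > 0`, `6(d−1)Lᵏ·δ ≤ ρ″`, dag-n12-w6's `hHB` at `(εH, B)`.  ANNOUNCED `∃ δ₀ > 0`.  THEN for every class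
tolerance `εr > 0` (floors, [4]-Prop.-2 smallness), every closed `reg' ⊇ closure U_k({Ω_j(Z)}, εr)` with continuous constrained averages, every datum tolerance `ρn ≥ 0` with `T(ρn, εr) ≤ δ₀`,
and per base field (E) · `PlaqSmallOn (plaqsInside (pts k Z)) δ (ext V_k)` · `∀ e, e.src ∈ pts k Z → e.tgt ∈ pts k Z → dist1 ((ext V_k) e) ≤ ρn` · (T1@q₀): the (J0′) conclusion VERBATIM at
the class `U_k({Ω_j(Z)}, εr)`.  Proof: `…_threshold_residual_uniform` at `δc := T(ρn, εr)`, the (σ, (δ)) row per base field from `exists_gaugeLetterLoc_atRecord_lamBondsSeq_explicit_onZ` at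
`ν⟨εreg := εr⟩`, `W := ext V_k`.
[cite: Balaban1989LargeFieldII, p.357, (1.12)–(1.13) p.359; Balaban1989LargeFieldI, (1.74) p.192, Prop. 1 p.194; Balaban1985Variational, (2)–(4) p.278, Thm 1 p.279, (16)–(18) p.280, Sect. C (44)–(48) p.285, (181) p.307; Balaban1985RegularSpaces, (1.7) p.77, (1.19) p.79; Balaban1985Averaging, Prop. 2 (52)–(53) p.26, (122)–(126) p.36; Balaban1988Convergent, (1.3) p.246, (2.2) p.255, (2.10)–(2.13) pp.256–257, (2.16) p.257] -/
theorem hMin_atRecord_of_node00Letters_thm1AtBase_central_ofClass_datumLettersOnZ_uniform (ν : Node00.Stage7Numerics) (Kt : ℕ) (hd : 2 ≤ (F.P Kt).d) (Z : Set (Site (F.P Kt) 0)) (𝔅 : BDetSet (F.P Kt)) (h𝔅Z : 𝔅 = lamBondsSeq (maxDomT ν.M₁ Z) k) (hkK : k + 1 ≤ (F.P Kt).m + (F.P Kt).K)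
    (hM4 : 4 * (F.P Kt).L ≤ ν.M₁) (hdiv : side (F.P Kt).L ν.M₁ k ∣ (F.P Kt).sitesPerDir 0) (hZblk : B14.Eq22Determines.IsBlockUnion k Z)
    {ρ'' : ℝ} (hsbU : ∀ W : GaugeField (F.P Kt) 0 SU2, ‖coeField W - 1‖ ≤ ρ'' → SmallBelow (Node00.avOfRecord F 2 Kt) k W)
    (hρ : 0 < ρ'')
    (hk0 : 0 < k)
    -- ONCE per height: the right-inverse letter of the real chart (dag-n12-w6's `hHB`, inhabited by `N12HsurjOfClass.exists_hsurjLetters`)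
    {εH B : ℝ}
    (hHB : ∀ (Wd : MSField (F.P Kt) SU2) (U₀ : GaugeField (F.P Kt) 0 SU2),
      AgreeOn (Bj ν.M₁ Z k) (avgFamily (avOfRecord F 2 Kt) U₀) Wd →
      (∀ i' : Fin (constrCard (Bj ν.M₁ Z k) k), ∃ U' : GaugeField (F.P Kt) 0 SU2,
        (∀ b ∈ feeds (((constrEnum (Bj ν.M₁ Z k) k).symm i').1 : ℕ) ((constrEnum (Bj ν.M₁ Z k) k).symm i').2.1, U' b = U₀ b) ∧
          SmallBelow (avOfRecord F 2 Kt) k U') →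
      (∀ (j : ℕ), 1 ≤ j → j ≤ k → ∀ y : Site (F.P Kt) j, embIter j y ∈ maxDomT ν.M₁ Z j → ∃ U' : GaugeField (F.P Kt) 0 SU2,
        (∀ c : PBond (F.P Kt) j, (c.src = y ∨ c.tgt = y) → ∀ b₀ : PBond (F.P Kt) 0,
          (iterBlockOf j b₀.src = c.src ∨ iterBlockOf j b₀.src = c.tgt) → (iterBlockOf j b₀.tgt = c.src ∨ iterBlockOf j b₀.tgt = c.tgt) → U' b₀ = U₀ b₀) ∧
        SmallBelow (avOfRecord F 2 Kt) k U') →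
      (∀ (j : ℕ), 1 ≤ j → j ≤ k → ∀ y : Site (F.P Kt) j, embIter j y ∈ maxDomT ν.M₁ Z j →
        PlaqSmallOn (boxPlaqs (fun κ => lift (F.P Kt) (embIter j y) κ - ((((F.P Kt).L ^ j : ℕ) : ℤ) + ((((F.P Kt).L ^ j - 1) / 2 : ℕ) : ℤ)))
          (fun κ => lift (F.P Kt) (embIter j y) κ + ((((F.P Kt).L ^ j : ℕ) : ℤ) + ((((F.P Kt).L ^ j - 1) / 2 : ℕ) : ℤ))) : Set (Plaq (F.P Kt) 0)) εH U₀) →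
      ∃ H : (Fin (constrCard (Bj ν.M₁ Z k) k) → lieSU (Fin 2)) → PBond (F.P Kt) 0 → lieSU (Fin 2),
        (∀ v, fderiv ℝ (msChart F 2 Kt k (Bj ν.M₁ Z k) Wd U₀) 0 (H v) = v) ∧ ∀ v, Real.sqrt (∑ b, ‖H v b‖ ^ 2) ≤ B * ‖v‖) (hB0 : 0 ≤ B)
    -- ONE forest and its axial slice per instance (dag-n12-w3's `N12ForestSlice.exists_forest_slice_Bj`): (F1), (F2), (TREE), (F3)
    (path : Site (F.P Kt) 0 → List (LStep (F.P Kt) 0)) (S : Submodule ℂ (VecField (F.P Kt) 0 (EuclideanSpace ℂ (Fin 3))))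
    (hF1 : ∀ x, ∀ s ∈ path x, ∃ x' x'' : Site (F.P Kt) 0, path x'' = path x' ++ [s] ∧
        (s.fwd = true → s.bond.src = x' ∧ s.bond.tgt = x'') ∧ (s.fwd = false → s.bond.src = x'' ∧ s.bond.tgt = x'))
    (hF2 : ∀ j, j ≤ k → ∀ c ∈ (𝔅 j), path (embIter j c.src) = [] ∧ path (embIter j c.tgt) = [])
    (hTREE : ∀ x : Site (F.P Kt) 0, x ∉ {z : Site (F.P Kt) 0 | ∃ j, j ≤ k ∧ ∃ c ∈ (𝔅 j), (z = embIter j c.src ∨ z = embIter j c.tgt)} →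
      ∃ (x' : Site (F.P Kt) 0) (s : LStep (F.P Kt) 0), path x = path x' ++ [s] ∧
        (s.fwd = true → s.bond.src = x' ∧ s.bond.tgt = x) ∧ (s.fwd = false → s.bond.src = x ∧ s.bond.tgt = x'))
    (hF3 : ∀ X : VecField (F.P Kt) 0 (EuclideanSpace ℂ (Fin 3)), X ∈ S ↔ ∀ x, ∀ s ∈ path x, X s.bond = 0)
    -- (σ)_N OF RECORD (dag-n12-w3's `N12GaugeLetterLocExplicitLam.exists_gaugeLetterLoc_atRecord_lamBondsSeq_explicit`), instance-level letters VERBATIM: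
    -- NUMERICS (i): a level guard `k + c ≤ m + K` with `4d + m′ + 3 < 2·L^c` (no wrapping), and `M₁ ≥ (4d + m′)·L² + 2d·L + 12` (radii), `m′ = 3·(d·((L−1)∕2)) + 5`
    {c : ℕ} (hkc : k + c ≤ (F.P Kt).m + (F.P Kt).K) (hc : 4 * (F.P Kt).d + (3 * ((F.P Kt).d * (((F.P Kt).L - 1) / 2)) + 5) + 3 < 2 * (F.P Kt).L ^ c)
    (hMrad : (4 * (F.P Kt).d + (3 * ((F.P Kt).d * (((F.P Kt).L - 1) / 2)) + 5)) * (F.P Kt).L ^ 2 + 2 * (F.P Kt).d * (F.P Kt).L + 12 ≤ ν.M₁)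
    -- the family's support numerics: `M₁ ≥ ((d+4)L + 6)·L²`
    (hM₁ : (((F.P Kt).d + 4) * (F.P Kt).L + 6) * (F.P Kt).L ^ 2 ≤ ν.M₁) :
    -- THE GAUGE-TOLERANCE THRESHOLD `δ₀`, announced before the base fields; the (σ)_N tolerance of record must sit below it
    ∃ δ₀ : ℝ, 0 < δ₀ ∧
    -- THE WINDOW, THE DATUM's REGULARITY TOLERANCE, THE EXTENSION, THE COMPACT PARAMETER SET AND THE BOUND — ALL AFTER THE CONSTANTS
    ∀ (Λ : Set (Site (F.P Kt) k)) (lo hi : Fin (F.P Kt).d → ℤ) {δ : ℝ}, 0 < δ → 6 * ((((F.P Kt).d - 1 : ℕ)) : ℝ) * (F.P Kt).L ^ k * δ ≤ ρ'' →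
    ∀ (ext : GaugeField (F.P Kt) k SU2 → GaugeField (F.P Kt) k SU2), (∀ W, ext W = extend Λ (shellGauge W lo hi) W) →
    ∀ {K : Set (GaugeField (F.P Kt) k SU2)}, IsCompact K → ∀ {𝓐₀ : ℝ}, 1 < 𝓐₀ →
    -- THE CLASS TOLERANCE (positive, [4]-Prop.-2-small, below the floors), THE CLASS FACTS, THE DATUM TOLERANCE — ALL AFTER THE THRESHOLD (`ν⟨εreg := εr⟩`, `M₁` unchanged)
    ∀ (εr : ℝ), 0 < εr → 12 * ((((F.P Kt).d - 1 : ℕ)) : ℝ) * (F.P Kt).L * εr ≤ ρ'' → εr ≤ εH →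
    (143 * (((((F.P Kt).d + 4 : ℕ) : ℝ)) ^ 2 / 4) ^ 2) * (εr * (F.P Kt).L ^ 2) ≤ 1 / 3 →
    2 * (εr * (F.P Kt).L ^ 2) ≤ 2 * deltaSU (Fin 2) / ((((F.P Kt).d + 4) * (F.P Kt).L : ℕ) : ℝ) ^ 2 →
    (((((F.P Kt).d + 2) * (F.P Kt).L : ℕ) : ℝ) ^ 2 / 4) * (2 * (εr * (F.P Kt).L ^ 2)) < deltaSU (Fin 2) →
    ∀ (reg' : Set (GaugeField (F.P Kt) 0 SU2)), IsClosed reg' → closure (Node00.regMSCoPOfRecord F 2 {ν with εreg := εr} Kt k (maxDomT ν.M₁ Z)) ⊆ reg' →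
      ContinuousOn (fun (U : GaugeField (F.P Kt) 0 SU2) (i : Fin (constrCardB 𝔅 k)) =>
        ((avgFamily (Node00.avOfRecord F 2 Kt) U ((constrEnumB 𝔅 k).symm i).1 ((constrEnumB 𝔅 k).symm i).2.1 : SU2) : Matrix (Fin 2) (Fin 2) ℂ)) reg' →
    ∀ {ρn : ℝ}, 0 ≤ ρn →
    ((max ρn ((((2 * (∑ i ∈ Finset.range (k + 1), ((F.P Kt).d * (((F.P Kt).L ^ i - 1) / 2) + 1)) + 1 +
                  (3 * ((F.P Kt).d * (((F.P Kt).L - 1) / 2)) + 5) * (F.P Kt).L ^ k : ℕ) : ℝ)) ^ 2 / 4 * (εr * (F.P Kt).eta 0 ^ 2) +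
                ((3 * ((F.P Kt).d * (((F.P Kt).L - 1) / 2)) + 5 : ℕ) : ℝ) * (6 * ((((((F.P Kt).d + 2) * (F.P Kt).L : ℕ) : ℝ) ^ 2 / 4) * (2 * (εr * (F.P Kt).L ^ 2))) * ∑ i ∈ Finset.range k, ((F.P Kt).L : ℝ) ^ i) + ((3 * ((F.P Kt).d * (((F.P Kt).L - 1) / 2)) + 5 : ℕ) : ℝ) * ρn) ≤ δ₀) →
    (∀ Vk ∈ K, ∃ U₀ : GaugeField (F.P Kt) 0 SU2,
      IsMinimizerB (Node00.avOfRecord F 2 Kt) (Node00.regMSCoPOfRecord F 2 {ν with εreg := εr} Kt k (maxDomT ν.M₁ Z)) 𝔅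
        (avgFamily (Node00.avOfRecord F 2 Kt) (qsstarGIter0 k (ext Vk))) U₀ ∧
      PlaqSmallOn (plaqsInside (pts k Z)) δ (ext Vk) ∧
      -- THE DATUM LETTER ON `Z^{(k)}` (dag-n12-w6 g18's onZ producer): `ext V_k` is `ρn`-flat on the `k`-bonds INSIDE `Z^{(k)}`
      (∀ e : PBond (F.P Kt) k, e.src ∈ pts k Z → e.tgt ∈ pts k Z → dist1 ((ext Vk) e) ≤ ρn) ∧
      -- (T1@q₀) — the capstone's row verbatim
      (∀ U ∈ reg', AgreeOnB 𝔅 (avgFamily (Node00.avOfRecord F 2 Kt) U) (avgFamily (Node00.avOfRecord F 2 Kt) (qsstarGIter0 k (ext Vk))) →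
        wilsonAction4 U ≤ wilsonAction4 U₀ →
          ∃ u : GaugeTransf (F.P Kt) 0 SU2, (∀ j, j ≤ k → ∀ b ∈ (𝔅 j), toMS u j b.src = toMS u j b.tgt ∧ ∀ g : SU2, toMS u j b.src * g = g * toMS u j b.src) ∧ gaugeAct u U = U₀)) →
    ∃ R : ℝ, 0 < R ∧ ∀ Vk ∈ K,
      ∃ Ũ : VecField (F.P Kt) k (EuclideanSpace ℂ (Fin 3)) × VecField (F.P Kt) k (EuclideanSpace ℂ (Fin 3)) → PBond (F.P Kt) 0 → Matrix (Fin 2) (Fin 2) ℂ,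
        (∀ b i j, DifferentiableOn ℂ (fun z => Ũ z b i j) (ball 0 R)) ∧
        (∀ z ∈ ball (0 : VecField (F.P Kt) k (EuclideanSpace ℂ (Fin 3)) × VecField (F.P Kt) k (EuclideanSpace ℂ (Fin 3))) R, ∀ b i j, ‖Ũ z b i j‖ ≤ 𝓐₀) ∧
        ∀ p B' : VecField (F.P Kt) k E3, ‖p‖ < R → ‖B'‖ < R → ∃ U' : GaugeField (F.P Kt) 0 SU2,
          (∀ b, Ũ (cplxVec p, cplxVec B') b = ((U' b : SU2) : Matrix (Fin 2) (Fin 2) ℂ)) ∧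
            IsMinimizerB (Node00.avOfRecord F 2 Kt) (Node00.regMSCoPOfRecord F 2 {ν with εreg := εr} Kt k (maxDomT ν.M₁ Z)) 𝔅
              (avgFamily (Node00.avOfRecord F 2 Kt) (qsstarGIter0 k (expMul su2Chart B' (ext (expMul su2Chart p Vk))))) U')
:= by
  obtain ⟨δ₀, hδ₀, h⟩ := hMin_atRecord_of_node00Letters_thm1AtBase_central_ofClass_threshold_residual_uniform ν Kt hd Z 𝔅 h𝔅Z hkK hM4 hdiv hZblk hsbU hρ
    hk0 {b : PBond (F.P Kt) 0 | b.src ∈ maxDomT ν.M₁ Z 1 ∨ b.tgt ∈ maxDomT ν.M₁ Z 1}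
    (fun b hb => mem_lamDatumP_maxDomT_zero_of_not_mem₂ (le_trans (le_trans (F.P Kt).L_pos (by omega)) hM4) hk0 (Nat.le_of_succ_le hkK) hdiv b (fun h => hb (Or.inl h)) fun h => hb (Or.inr h))
    (fun b hb => Or.inl hb) hHB hB0 path S hF1 hF2 hTREE hF3
  refine ⟨δ₀, hδ₀, fun Λ lo hi {δ} hδ hδρ ext hext {K} hK {𝓐₀} h𝓐₀ εr hεpos hερ hεH hα3 hα2 haN reg' hreg' hcl hDreg' {ρn} hρn hT hbase =>
    h Λ lo hi hδ hδρ ext hext hK h𝓐₀ εr hεpos.le hερ hεH reg' hreg' hcl hDreg' ?_ hT fun Vk hVk => ?_⟩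
  · exact le_trans hρn (le_max_left _ _)
  obtain ⟨U₀, hmin, hreg, hD, hT1⟩ := hbase Vk hVk
  subst h𝔅Z
  have hk : k ≤ (F.P Kt).m + (F.P Kt).K := Nat.le_of_succ_le hkK
  obtain ⟨σ, hσ, -, hZb⟩ := exists_gaugeLetterLoc_atRecord_lamBondsSeq_explicit_onZ {ν with εreg := εr} Kt hk0 hk hdiv Z hZblk hkc hc hMrad hρn (ext Vk) hD hmin
    hεpos hα3 hα2 haN hM₁
  -- (δ) on the plaquettes meeting the TOUCHING set: all four bonds of such a plaquette lie inside `Z` (`corners_mem_of_touching`), where the residual gauge is flat bondwise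
  have hM4' : 4 ≤ ν.M₁ := le_trans (by omega) hMrad
  refine ⟨U₀, σ, hmin, hreg, hσ, fun p hp => ?_, hT1⟩
  obtain ⟨h1, h2, h3, h4, h4'⟩ := corners_mem_of_touching (F := F) (ν := ν) (Z := Z) hM4' hk0 hdiv p hp
  exact ⟨hZb _ h1 h2, hZb _ h2 h4, hZb _ h3 h4', hZb _ h1 h3⟩

end

end Summit.QuantumFields.YangMills.BalabanUVNodes.N12MinimiserFamilyOfClassDatumLettersOnZUniformB

end
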